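import Summits.Ventures.HodgeRepro2.T5SU11SphericalTransformKernel
import Summits.Ventures.HodgeRepro2.T5SU11ResolventTransformClass
import Summits.Ventures.HodgeRepro2.T5SU11KernelCompositionSymmetric

/-!
# The spherical transform of the composed kernels: `∫ K_λ^{∘(k+1)}(t, s) φ_{λ′}(a_t) sinh 2t dt = φ_{λ′}(a_s)/(μ′ − μ)^{k+1}`

Row 520's diagonalisation `∫ (G^I_λ g) φ_{λ′} sinh 2t dt = (∫ g φ_{λ′} sinh 2s ds)/(μ′ − μ)` (class sources of a rate `ε > λ′`,
`1 < λ′ < λ`) applied to the composed kernel `K_λ^{∘(k+1)}(·, s) = (G^I_λ)^k K_λ(·, s)` — a class source at every rate `< λ`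
(row 503) — and row 519's `∫ K_λ(t, s) φ_{λ′}(a_t) sinh 2t dt = φ_{λ′}(a_s)/(μ′ − μ)` give, by induction on `k`,

* `integral_kernel_comp_mul_sph_fst` — **`∫ K_λ^{∘(k+1)}(t, s) φ_{λ′}(a_t) sinh 2t dt = φ_{λ′}(a_s)/(μ′ − μ)^{k+1}`**;
* `integral_kernel_comp_mul_sph` — **`∫ K_λ^{∘(k+1)}(t, s) φ_{λ′}(a_s) sinh 2s ds = φ_{λ′}(a_t)/(μ′ − μ)^{k+1}`** (the symmetry of the
  composed kernels, row 582): the spherical transform of the composed kernels' rows is the `(k+1)`-st power of the resolvent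
  kernel in the spectral variable — the spectral picture of `(L − μ)^{−(k+1)}`.

Nothing is claimed about (N).

Blind lane: Mathlib + the HodgeRepro2 prefix only; no sorry; axioms ⊆ {propext, Classical.choice,
Quot.sound}.
-/

namespace Summit.Ventures.HodgeRepro2.T5SU11SphericalTransformKernelComp

open Filter Topology MeasureTheory
open Set (Ioi Ioc)
open T5SU11Cartan T5SU11SphericalFunction T5SU11SphericalBounds T5SU11SphericalContinuous T5SU11SphericalDecay
  T5SU11RadialGreenKernel T5SU11RadialGreenImproper T5SU11ResolventNeumann T5SU11KernelDifferenceRegularity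
  T5SU11ResolventTransformClass T5SU11KernelCompositionSymmetric

section measure

variable [MeasurableSpace Circle] [BorelSpace Circle]

variable {lam lam' : ℝ} (hlam : 1 < lam) (h1 : 1 < lam') (h2 : lam' < lam)

include hlam h1 h2 in
/-- **The spherical transform of the composed kernels in the first variable**:
`∫ K_λ^{∘(k+1)}(t, s) φ_{λ′}(a_t) sinh 2t dt = φ_{λ′}(a_s)/(μ′ − μ)^{k+1}` for `1 < λ′ < λ`, `s > 0`. -/
theorem integral_kernel_comp_mul_sph_fst {s : ℝ} (hs : 0 < s) (k : ℕ) :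
    ∫ t in Ioi 0, ((greenSolI (fun t => sph lam (hyp t)) (sphDecay lam))^[k] (fun r => sphGreenKernel lam r s)) t
        * sph lam' (hyp t) * Real.sinh (2 * t)
      = (1 / (lam' * (lam' - 2) - lam * (lam - 2))) ^ (k + 1) * sph lam' (hyp s) := by
  induction k with
  | zero =>
    simp only [Function.iterate_zero, id_eq, zero_add, pow_one]
    rw [integral_kernel_mul_sph_fst hlam h1 h2 hs]
    ring
  | succ k ih =>
    -- the class data of `(G^I_λ)^k K_λ(·, s)` at the rate `(λ′ + λ)/2 ∈ (λ′, λ)` (row 503)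
    obtain ⟨Ms, hMs0, hMs⟩ := kernel_source_bounded hlam hs
    obtain ⟨Cs, s₀, hCs⟩ := kernel_source_decay hlam hs
    have hks := kernel_source_continuousOn hlam hs
    have hεk : 2 - lam < lam := by linarith
    obtain ⟨hck, ⟨Mk, hMk0, hMk⟩, hdk⟩ := iterate_class (lam₂ := lam) hlam hks hMs hMs0 hεk hCs k
    obtain ⟨Kk, Tk, _, _, hKk⟩ := hdk ((lam' + lam) / 2) (by rw [min_self]; linarith)
    have hε : lam' < (lam' + lam) / 2 := by linarith
    have htr := transform_greenSolI_eq hlam h1 h2 hck hMk hMk0 hε hKk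
    have e : ∀ t : ℝ, ((greenSolI (fun t => sph lam (hyp t)) (sphDecay lam))^[k + 1] (fun r => sphGreenKernel lam r s)) t
        = greenSolI (fun t => sph lam (hyp t)) (sphDecay lam)
          ((greenSolI (fun t => sph lam (hyp t)) (sphDecay lam))^[k] (fun r => sphGreenKernel lam r s)) t :=
      fun t => by rw [Function.iterate_succ_apply']
    simp only [e]
    rw [htr, ih, pow_succ]
    ring

include hlam h1 h2 in
/-- **THE SPHERICAL TRANSFORM OF THE COMPOSED KERNELS' ROWS**:
`∫ K_λ^{∘(k+1)}(t, s) φ_{λ′}(a_s) sinh 2s ds = φ_{λ′}(a_t)/(μ′ − μ)^{k+1}` for `1 < λ′ < λ`, `t > 0`. -/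
theorem integral_kernel_comp_mul_sph {t : ℝ} (ht : 0 < t) (k : ℕ) :
    ∫ s in Ioi 0, ((greenSolI (fun t => sph lam (hyp t)) (sphDecay lam))^[k] (fun u => sphGreenKernel lam u s)) t
        * sph lam' (hyp s) * Real.sinh (2 * s)
      = (1 / (lam' * (lam' - 2) - lam * (lam - 2))) ^ (k + 1) * sph lam' (hyp t) := by
  rw [← integral_kernel_comp_mul_sph_fst hlam h1 h2 ht k]
  apply setIntegral_congr_fun measurableSet_Ioi
  intro s hs
  have hs' : (0 : ℝ) < s := hs
  dsimp only
  rw [kernel_comp_symm hlam k ht hs']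

end measure

end Summit.Ventures.HodgeRepro2.T5SU11SphericalTransformKernelComp
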